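import Summits.Ventures.Crystal3D.Theorems.StickyWulffConstantCoaxialWallLawSkewArithmetic
import Summits.Ventures.Crystal3D.Theorems.StickyWulffConstantCoaxialWallLawSkewRoots
import Summits.Ventures.Crystal3D.Theorems.StickyWulffConstantCoaxialWallLawWordTransPlane
import Summits.Ventures.Crystal3D.Theorems.StickyWulffConstantCoaxialWallLawTransGeneric
import Summits.Ventures.Crystal3D.Theorems.StickyWulffConstantCoaxialWallLawInPlaneTwin
import Summits.Ventures.Crystal3D.Theorems.StickyWulffConstantCoaxialWallLawFluxGapAll
import Summits.Ventures.Crystal3D.Theorems.StickyWulffConstantCoaxialWallLawTriadic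
import HarnessLib

/-!
# The union theorem of branch F, stub form: `stub_coaxialTwoSlabAdhesion` VERBATIM with `½ ↦ √2/11440`

HONEST FRAMING. Part of the venture `Summits/Ventures/Crystal3D` (cell `crystal3d-full`), helper
`--supports` the crux `CoaxialWallLaw` (stmt-Ventures-19481, `route-Ventures-StickyWulffConstant`),
REGISTERED line `WallLedgerF` (planner cf-p1 gen 16), open stub `stub_coaxialTwoSlabAdhesion`.
RUNG CREDIT ONLY — this is NOT the stub: the constant is `√2/11440 ≈ 1.24·10⁻⁴`, not `½`.

**Theorem (`coaxialTwoSlabAdhesion_smallCharge`).**  The registered stub `CoaxialTwoSlabAdhesion` of line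
`WallLedgerF` with its constant `(1/2 : ℝ)` replaced by `(√2/11440 : ℝ)` and the kissing facts `KissingGap δ`,
`KissingClassification δ` taken BY NAME: for EVERY co-axial pair of DISTINCT moved fcc lattices
`Λ₁ = A₁·Λ₀ + t₁ ≠ Λ₂ = A₂·Λ₀ + t₂` there are a shared Barlow frame `L` with its data (the defender picks the axis
`m = L e₃`) and `C`, `R₀ ≥ 1` such that for every `h ≥ 0`, `ρ ≥ R₀`, every `1`-separated filling `X` of the
clamped cylinder cell with the two complete slab samples,

  `cross(P₁, X∖P₁) + cross(P₂, Y) ≤ D(Y) + (φ₁ + φ₂ − (√2/11440)·√(1 − ⟪L e₃, e₃⟫²)) π ρ² + C (1 + h) ρ`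

— h-UNIFORM, RESIDUAL-FREE, ARBITRARY fillings, EVERY inclination, EVERY co-axial pair.  Assembly of the landed
rungs by the skew-root trichotomy (`…SkewArithmetic`, `…SkewRoots`) on the offset `τ = A₁⁻¹(t₂ − t₁)` of a
translation pair (`A₁·Λ₀ = A₂·Λ₀`; `coaxialTwoSlabAdhesion_translate_smallCharge`):
* (A) all `pᵢ ± pⱼ ∈ ℤ` ⇒ `τ` 3-adically generic ⇒ 19481-p1's `coaxialTwoSlabAdhesion_general_trans_generic`
  (charge `√6/17160 ≥ √2/11440`, frame `L`);
* (B) a doubly skew cubic axis ⇒ a skew-rooted slot of rise `≥ ½` ⇒ 19481-p2's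
  `translate_twoSlabAdhesion_general_net` (charge `√2·½/5720 = √2/11440`, frame `L`);
* (C) a skew `{111}` plane `ε` ⇒ the defender's frame `L' = A₁ ∘ G` (`G` a lattice symmetry with `G e₃ ∥ ε`) in
  which every non-basal slot is skew ⇒ 19481-p2's `coaxialTwoSlabAdhesion_general_trans_net`
  (charge `(√6/11440)·sin θ_{L'}`, frame `L'`);
and twin pairs (`A₁·Λ₀ ≠ A₂·Λ₀`) by 19481-p1's `coaxialTwoSlabAdhesion_general_twin_inPlane`
(charge `(√6/11440)·sin θ_L`).  The crux form (`CoaxialWallLaw` verbatim with `½ ↦ √2/11440`) is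
`…CoaxialWallLawSmallCharge`.

WHAT THIS IS NOT: not the stub (constant `√2/11440 ≪ ½`: the remaining factor is local accounting × class
multiplicity, R41f); F-C1 not moved.
-/

noncomputable section

namespace Summit.Ventures.Crystal3D.Theorems

open Summit.Ventures.Crystal3D Finset NearIdentity
open Literature.MathematicalPhysics.StatisticalMechanics (fccStacking barlowStacking IsHaggSeq constHagg
  isHaggSeq_const contactDeficiency)
open scoped InnerProductSpace

/-- **A translation pair in a common Barlow frame has `σ 0 = σ' 0`.** -/
theorem hagg_zero_eq_of_image_eq
    (A₁ A₂ L : EuclideanSpace ℝ (Fin 3) ≃ₗᵢ[ℝ] EuclideanSpace ℝ (Fin 3)) (t₁ t₂ s₁ s₂ : EuclideanSpace ℝ (Fin 3))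
    {σ σ' : ℤ → ℤ} (hσ : IsHaggSeq σ) (hσ' : IsHaggSeq σ')
    (hsub₁ : (fun p => A₁ p + t₁) '' fccStacking 1 (Real.sqrt (2 / 3)) ⊆
      (fun p => L p + s₁) '' barlowStacking 1 (Real.sqrt (2 / 3)) σ)
    (hsub₂ : (fun p => A₂ p + t₂) '' fccStacking 1 (Real.sqrt (2 / 3)) ⊆
      (fun p => L p + s₂) '' barlowStacking 1 (Real.sqrt (2 / 3)) σ')
    (htrans : A₁ '' fccStacking 1 (Real.sqrt (2 / 3)) = A₂ '' fccStacking 1 (Real.sqrt (2 / 3))) :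
    σ 0 = σ' 0 := by
  by_contra htw
  obtain ⟨-, f₁⟩ := linear_image_eq_frame_of_subset A₁ L t₁ s₁ hσ hsub₁
  obtain ⟨-, f₂⟩ := linear_image_eq_frame_of_subset A₂ L t₂ s₂ hσ' hsub₂
  have hinj : Function.Injective (fun S : Set (EuclideanSpace ℝ (Fin 3)) => L '' S) :=
    Set.image_injective.2 L.injective
  rcases hσ 0 with h1 | h1 <;> rcases hσ' 0 with h2 | h2
  · exact htw (h1.trans h2.symm)
  · rw [h1] at f₁; rw [h2] at f₂
    have key := hinj (f₁.symm.trans (htrans.trans f₂))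
    exact fcc_ne_halfTurn_image (key.trans barlowStacking_negConst_eq_halfTurn_image)
  · rw [h1] at f₁; rw [h2] at f₂
    have key := hinj (f₂.symm.trans (htrans.symm.trans f₁))
    exact fcc_ne_halfTurn_image (key.trans barlowStacking_negConst_eq_halfTurn_image)
  · exact htw (h1.trans h2.symm)

/-- **Distinct translates have an offset outside the lattice**: if `A₁·Λ₀ = A₂·Λ₀` and the moved lattices
differ, then `A₁⁻¹(t₂ − t₁) ∉ Λ₀`. -/
theorem offset_notMem_of_ne (A₁ A₂ : EuclideanSpace ℝ (Fin 3) ≃ₗᵢ[ℝ] EuclideanSpace ℝ (Fin 3))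
    (t₁ t₂ : EuclideanSpace ℝ (Fin 3))
    (htrans : A₁ '' fccStacking 1 (Real.sqrt (2 / 3)) = A₂ '' fccStacking 1 (Real.sqrt (2 / 3)))
    (hne : (fun p => A₁ p + t₁) '' fccStacking 1 (Real.sqrt (2 / 3)) ≠
      (fun p => A₂ p + t₂) '' fccStacking 1 (Real.sqrt (2 / 3))) :
    A₁.symm (t₂ - t₁) ∉ fccStacking 1 (Real.sqrt (2 / 3)) := by
  intro hτ
  apply hne
  have hΛ₂ : (fun q => A₂ q + t₂) '' fccStacking 1 (Real.sqrt (2 / 3)) =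
      (fun q => A₁ q + t₂) '' fccStacking 1 (Real.sqrt (2 / 3)) := by
    have e2 : (fun q => A₂ q + t₂) '' fccStacking 1 (Real.sqrt (2 / 3)) =
        (fun y => y + t₂) '' (A₂ '' fccStacking 1 (Real.sqrt (2 / 3))) := by rw [Set.image_image]
    have e1 : (fun q => A₁ q + t₂) '' fccStacking 1 (Real.sqrt (2 / 3)) =
        (fun y => y + t₂) '' (A₁ '' fccStacking 1 (Real.sqrt (2 / 3))) := by rw [Set.image_image]
    rw [e2, e1, htrans]
  have ht₂ : t₂ = A₁ (A₁.symm (t₂ - t₁)) + t₁ := by rw [A₁.apply_symm_apply]; abel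
  rw [hΛ₂]
  ext y
  constructor
  · rintro ⟨x, hx, rfl⟩
    refine ⟨x - A₁.symm (t₂ - t₁), fcc_sub_site_mem hx hτ, ?_⟩
    simp only [map_sub, A₁.apply_symm_apply]; abel
  · rintro ⟨x, hx, rfl⟩
    refine ⟨x + A₁.symm (t₂ - t₁), fcc_add_site_mem hx hτ, ?_⟩
    simp only [map_add, A₁.apply_symm_apply]; abel

/-- **3-adic genericity from the lattice form.**  `3^k τ ∉ Λ₀` for all `k` (`τ = A₁⁻¹(t₂ − t₁)`,
`A₁·Λ₀ = A₂·Λ₀`) gives the genericity hypothesis of `coaxialTwoSlabAdhesion_general_trans_generic`. -/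
theorem hgen_of_pow_smul_notMem (A₁ A₂ : EuclideanSpace ℝ (Fin 3) ≃ₗᵢ[ℝ] EuclideanSpace ℝ (Fin 3))
    (t₁ t₂ : EuclideanSpace ℝ (Fin 3))
    (htrans : A₁ '' fccStacking 1 (Real.sqrt (2 / 3)) = A₂ '' fccStacking 1 (Real.sqrt (2 / 3)))
    (hgen : ∀ k : ℕ, ((3 : ℝ) ^ k) • A₁.symm (t₂ - t₁) ∉ fccStacking 1 (Real.sqrt (2 / 3))) :
    ∀ k : ℕ, ∀ p ∈ (fun x => A₁ x + t₁) '' fccStacking 1 (Real.sqrt (2 / 3)),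
      ∀ p' ∈ (fun x => A₁ x + t₁) '' fccStacking 1 (Real.sqrt (2 / 3)),
      ∀ q ∈ (fun x => A₂ x + t₂) '' fccStacking 1 (Real.sqrt (2 / 3)), ((3 : ℝ) ^ k) • (q - p) ≠ p' - p := by
  rintro k _ ⟨x, hx, rfl⟩ _ ⟨x', hx', rfl⟩ _ ⟨y, hy, rfl⟩ heq
  obtain ⟨y', hy', hyy'⟩ : A₂ y ∈ A₁ '' fccStacking 1 (Real.sqrt (2 / 3)) := by rw [htrans]; exact ⟨y, hy, rfl⟩
  apply hgen k
  have hpow : ((3 : ℝ) ^ k) • (y' - x) ∈ fccStacking 1 (Real.sqrt (2 / 3)) := by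
    have := fcc_zsmul_mem (3 ^ k) (fcc_sub_site_mem hy' hx)
    push_cast at this
    exact this
  have key : ((3 : ℝ) ^ k) • A₁.symm (t₂ - t₁) = (x' - x) - ((3 : ℝ) ^ k) • (y' - x) := by
    apply A₁.injective
    rw [LinearIsometryEquiv.map_smul, A₁.apply_symm_apply, map_sub, LinearIsometryEquiv.map_smul, map_sub, map_sub]
    have e : ((3 : ℝ) ^ k) • (A₂ y + t₂ - (A₁ x + t₁)) = A₁ x' + t₁ - (A₁ x + t₁) := heq
    rw [← hyy'] at e
    have e' : ((3 : ℝ) ^ k) • (t₂ - t₁) = (A₁ x' - A₁ x) - ((3 : ℝ) ^ k) • (A₁ y' - A₁ x) := by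
      have : ((3 : ℝ) ^ k) • (A₁ y' + t₂ - (A₁ x + t₁)) =
          ((3 : ℝ) ^ k) • (A₁ y' - A₁ x) + ((3 : ℝ) ^ k) • (t₂ - t₁) := by
        rw [← smul_add]; congr 1; abel
      rw [this] at e
      have e2 : A₁ x' + t₁ - (A₁ x + t₁) = A₁ x' - A₁ x := by abel
      rw [e2] at e
      exact eq_sub_of_add_eq' e
    exact e'
  rw [key]
  exact fcc_sub_site_mem (fcc_sub_site_mem hx' hx) hpow

/-- **The skew trichotomy of an offset, indexed form** (`p = √2 · cubicCoords τ`): (A) all `pᵢ ± pⱼ ∈ ℤ`;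
(B) a doubly skew axis `k`; (C) a skew sign vector `cubeInt c`. -/
theorem skew_trichotomy_fin (τ : EuclideanSpace ℝ (Fin 3)) :
    (∀ i j : Fin 3, i ≠ j → (∃ z : ℤ, Real.sqrt 2 * cubicCoords τ i + Real.sqrt 2 * cubicCoords τ j = z) ∧
      (∃ z : ℤ, Real.sqrt 2 * cubicCoords τ i - Real.sqrt 2 * cubicCoords τ j = z)) ∨
    (∃ k : Fin 3, ∀ i : Fin 3, i ≠ k →
      (¬ ∃ z : ℤ, Real.sqrt 2 * cubicCoords τ k + Real.sqrt 2 * cubicCoords τ i = z) ∧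
      (¬ ∃ z : ℤ, Real.sqrt 2 * cubicCoords τ k - Real.sqrt 2 * cubicCoords τ i = z)) ∨
    (∃ c : Fin 8, ∀ k i : Fin 3, k ≠ i → ¬ ∃ z : ℤ,
      (cubeInt c k : ℝ) * (Real.sqrt 2 * cubicCoords τ k) + (cubeInt c i : ℝ) * (Real.sqrt 2 * cubicCoords τ i) = z) := by
  -- symmetric closures of the two predicates
  have symI : ∀ x y : ℝ, ((∃ z : ℤ, x + y = z) ∧ (∃ z : ℤ, x - y = z)) →
      ((∃ z : ℤ, y + x = z) ∧ (∃ z : ℤ, y - x = z)) := by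
    rintro x y ⟨⟨z, hz⟩, ⟨z', hz'⟩⟩
    exact ⟨⟨z, by linarith⟩, ⟨-z', by push_cast; linarith⟩⟩
  have symN : ∀ x y : ℝ, ((¬ ∃ z : ℤ, x + y = z) ∧ (¬ ∃ z : ℤ, x - y = z)) →
      ((¬ ∃ z : ℤ, y + x = z) ∧ (¬ ∃ z : ℤ, y - x = z)) := by
    rintro x y ⟨h, h'⟩
    exact ⟨fun ⟨z, hz⟩ => h ⟨z, by linarith⟩, fun ⟨z, hz⟩ => h' ⟨-z, by push_cast; linarith⟩⟩
  have symE : ∀ e e' x y : ℝ, (¬ ∃ z : ℤ, e * x + e' * y = z) → ¬ ∃ z : ℤ, e' * y + e * x = z := by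
    rintro e e' x y h ⟨z, hz⟩; exact h ⟨z, by linarith⟩
  set a := Real.sqrt 2 * cubicCoords τ 0 with ha
  set b := Real.sqrt 2 * cubicCoords τ 1 with hb
  set c := Real.sqrt 2 * cubicCoords τ 2 with hc
  rcases real_skew_trichotomy a b c with ⟨h01, h01', h02, h02', h12, h12'⟩ | hB | hB | hB |
      ⟨ε₀, ε₁, ε₂, hε₀, hε₁, hε₂, e01, e02, e12⟩
  · refine Or.inl fun i j hij => ?_
    fin_cases i <;> fin_cases j <;>
      simp only [Fin.isValue, Fin.zero_eta, Fin.mk_one, Fin.reduceFinMk, ne_eq, not_true_eq_false] at hij ⊢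
    · exact ⟨h01, h01'⟩
    · exact ⟨h02, h02'⟩
    · exact symI _ _ ⟨h01, h01'⟩
    · exact ⟨h12, h12'⟩
    · exact symI _ _ ⟨h02, h02'⟩
    · exact symI _ _ ⟨h12, h12'⟩
  · refine Or.inr (Or.inl ⟨0, fun i hi => ?_⟩)
    fin_cases i <;>
      simp only [Fin.isValue, Fin.zero_eta, Fin.mk_one, Fin.reduceFinMk, ne_eq, not_true_eq_false] at hi ⊢
    · exact ⟨hB.1, hB.2.1⟩
    · exact ⟨hB.2.2.1, hB.2.2.2⟩
  · refine Or.inr (Or.inl ⟨1, fun i hi => ?_⟩)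
    fin_cases i <;>
      simp only [Fin.isValue, Fin.zero_eta, Fin.mk_one, Fin.reduceFinMk, ne_eq, not_true_eq_false] at hi ⊢
    · exact symN _ _ ⟨hB.1, hB.2.1⟩
    · exact ⟨hB.2.2.1, hB.2.2.2⟩
  · refine Or.inr (Or.inl ⟨2, fun i hi => ?_⟩)
    fin_cases i <;>
      simp only [Fin.isValue, Fin.zero_eta, Fin.mk_one, Fin.reduceFinMk, ne_eq, not_true_eq_false] at hi ⊢
    · exact symN _ _ ⟨hB.1, hB.2.1⟩
    · exact symN _ _ ⟨hB.2.2.1, hB.2.2.2⟩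
  · obtain ⟨c', h0, h1, h2⟩ := exists_cubeInt_eq ε₀ ε₁ ε₂ hε₀ hε₁ hε₂
    refine Or.inr (Or.inr ⟨c', fun k i hki => ?_⟩)
    fin_cases k <;> fin_cases i <;>
      simp only [Fin.isValue, Fin.zero_eta, Fin.mk_one, Fin.reduceFinMk, ne_eq, not_true_eq_false] at hki ⊢
    · rw [h0, h1]; exact e01
    · rw [h0, h2]; exact e02
    · rw [h1, h0]; exact symE _ _ _ _ e01
    · rw [h1, h2]; exact e12
    · rw [h2, h0]; exact symE _ _ _ _ e02
    · rw [h2, h1]; exact symE _ _ _ _ e12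

open scoped Classical in
/-- **The union theorem for TRANSLATION pairs** (`A₁·Λ₀ = A₂·Λ₀`, `Λ₁ ≠ Λ₂`): the stub's conclusion with
`½ ↦ √2/11440`, for SOME frame (the given one in cases (A), (B); the skew plane's frame in case (C)). -/
theorem coaxialTwoSlabAdhesion_translate_smallCharge {δ : ℝ} (hg : KissingGap δ) (hc : KissingClassification δ)
    (A₁ : EuclideanSpace ℝ (Fin 3) ≃ₗᵢ[ℝ] EuclideanSpace ℝ (Fin 3)) (t₁ : EuclideanSpace ℝ (Fin 3))
    (A₂ : EuclideanSpace ℝ (Fin 3) ≃ₗᵢ[ℝ] EuclideanSpace ℝ (Fin 3)) (t₂ : EuclideanSpace ℝ (Fin 3))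
    (L : EuclideanSpace ℝ (Fin 3) ≃ₗᵢ[ℝ] EuclideanSpace ℝ (Fin 3)) (s₁ s₂ : EuclideanSpace ℝ (Fin 3))
    (σ σ' : ℤ → ℤ) (hσ : IsHaggSeq σ) (hσ' : IsHaggSeq σ')
    (hsub₁ : (fun p => A₁ p + t₁) '' fccStacking 1 (Real.sqrt (2 / 3)) ⊆
      (fun p => L p + s₁) '' barlowStacking 1 (Real.sqrt (2 / 3)) σ)
    (hsub₂ : (fun p => A₂ p + t₂) '' fccStacking 1 (Real.sqrt (2 / 3)) ⊆
      (fun p => L p + s₂) '' barlowStacking 1 (Real.sqrt (2 / 3)) σ')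
    (htrans : A₁ '' fccStacking 1 (Real.sqrt (2 / 3)) = A₂ '' fccStacking 1 (Real.sqrt (2 / 3)))
    (hne : (fun p => A₁ p + t₁) '' fccStacking 1 (Real.sqrt (2 / 3)) ≠
      (fun p => A₂ p + t₂) '' fccStacking 1 (Real.sqrt (2 / 3))) :
    ∃ (L : EuclideanSpace ℝ (Fin 3) ≃ₗᵢ[ℝ] EuclideanSpace ℝ (Fin 3))
        (s₁ s₂ : EuclideanSpace ℝ (Fin 3)) (σ σ' : ℤ → ℤ), IsHaggSeq σ ∧ IsHaggSeq σ' ∧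
        (fun p => A₁ p + t₁) '' fccStacking 1 (Real.sqrt (2 / 3)) ⊆
          (fun p => L p + s₁) '' barlowStacking 1 (Real.sqrt (2 / 3)) σ ∧
        (fun p => A₂ p + t₂) '' fccStacking 1 (Real.sqrt (2 / 3)) ⊆
          (fun p => L p + s₂) '' barlowStacking 1 (Real.sqrt (2 / 3)) σ' ∧
    ∃ C R₀ : ℝ, 1 ≤ R₀ ∧ ∀ h : ℝ, 0 ≤ h → ∀ ρ : ℝ, R₀ ≤ ρ →
      ∀ X P₁ P₂ : Finset (EuclideanSpace ℝ (Fin 3)),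
      (∀ p ∈ X, ∀ q ∈ X, p ≠ q → 1 ≤ dist p q) → P₁ ⊆ X → P₂ ⊆ X \ P₁ →
      (∀ p ∈ X, -(2 * R₀) ≤ p 2 ∧ p 2 ≤ h + 2 * R₀ ∧ p 0 ^ 2 + p 1 ^ 2 ≤ ρ ^ 2) →
      (∀ p, p ∈ P₁ ↔ (p ∈ (fun q => A₁ q + t₁) '' fccStacking 1 (Real.sqrt (2 / 3)) ∧
        -(2 * R₀) ≤ p 2 ∧ p 2 ≤ -R₀ ∧ p 0 ^ 2 + p 1 ^ 2 ≤ ρ ^ 2)) →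
      (∀ p, p ∈ P₂ ↔ (p ∈ (fun q => A₂ q + t₂) '' fccStacking 1 (Real.sqrt (2 / 3)) ∧
        h + R₀ ≤ p 2 ∧ p 2 ≤ h + 2 * R₀ ∧ p 0 ^ 2 + p 1 ^ 2 ≤ ρ ^ 2)) →
      ((((P₁ ×ˢ (X \ P₁)).filter fun pq => dist pq.1 pq.2 = 1).card : ℕ) : ℝ) +
        ((((P₂ ×ˢ ((X \ P₁) \ P₂)).filter fun pq => dist pq.1 pq.2 = 1).card : ℕ) : ℝ) ≤
        contactDeficiency ((X \ P₁) \ P₂) +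
          (Real.sqrt 2 / 4 * ∑ᶠ w ∈ {w ∈ fccStacking 1 (Real.sqrt (2 / 3)) | ‖w‖ = 1},
              |⟪w, A₁.symm (EuclideanSpace.single (2 : Fin 3) (1 : ℝ))⟫_ℝ| +
            Real.sqrt 2 / 4 * ∑ᶠ w ∈ {w ∈ fccStacking 1 (Real.sqrt (2 / 3)) | ‖w‖ = 1},
              |⟪w, A₂.symm (EuclideanSpace.single (2 : Fin 3) (1 : ℝ))⟫_ℝ| -
            (Real.sqrt 2 / 11440 : ℝ) * Real.sqrt (1 - ⟪L (EuclideanSpace.single (2 : Fin 3) (1 : ℝ)),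
              (EuclideanSpace.single (2 : Fin 3) (1 : ℝ))⟫_ℝ ^ 2)) * Real.pi * ρ ^ 2 +
          C * (1 + h) * ρ := by
  set e₃ : EuclideanSpace ℝ (Fin 3) := EuclideanSpace.single (2 : Fin 3) (1 : ℝ) with he₃
  set τ : EuclideanSpace ℝ (Fin 3) := A₁.symm (t₂ - t₁) with hτ
  have hτΛ : τ ∉ fccStacking 1 (Real.sqrt (2 / 3)) := offset_notMem_of_ne A₁ A₂ t₁ t₂ htrans hne
  -- sine bound `0 ≤ √(1 - ⟪M e₃, e₃⟫²) ≤ 1` for any frame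
  have hsin : ∀ M : EuclideanSpace ℝ (Fin 3) ≃ₗᵢ[ℝ] EuclideanSpace ℝ (Fin 3),
      0 ≤ Real.sqrt (1 - ⟪M e₃, e₃⟫_ℝ ^ 2) ∧ Real.sqrt (1 - ⟪M e₃, e₃⟫_ℝ ^ 2) ≤ 1 := by
    intro M
    refine ⟨Real.sqrt_nonneg _, ?_⟩
    rw [show (1 : ℝ) = Real.sqrt 1 from Real.sqrt_one.symm]
    exact Real.sqrt_le_sqrt (by rw [Real.sqrt_one]; nlinarith [sq_nonneg ⟪M e₃, e₃⟫_ℝ])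
  have hπρ : ∀ ρ : ℝ, 0 ≤ Real.pi * ρ ^ 2 := fun ρ => by positivity
  rcases skew_trichotomy_fin τ with hall | ⟨k, hk⟩ | ⟨c, hcube⟩
  · -- (A) all-integer pattern: 3-adically generic, frame `L`
    have hgen := hgen_of_pow_smul_notMem A₁ A₂ t₁ t₂ htrans (fun k => generic_of_allInt τ hall hτΛ k)
    have htw := hagg_zero_eq_of_image_eq A₁ A₂ L t₁ t₂ s₁ s₂ hσ hσ' hsub₁ hsub₂ htrans
    obtain ⟨C, R₀, hR₀, hmain⟩ := coaxialTwoSlabAdhesion_general_trans_generic hg hc A₁ t₁ A₂ t₂ L s₁ s₂ σ σ'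
      hσ hσ' hsub₁ hsub₂ htw hgen
    refine ⟨L, s₁, s₂, σ, σ', hσ, hσ', hsub₁, hsub₂, C, R₀, hR₀, ?_⟩
    intro h hh ρ hρ X P₁ P₂ hX hP₁X hP₂X₁ hcyl hP₁ hP₂
    have key := hmain h hh ρ hρ X P₁ P₂ hX hP₁X hP₂X₁ hcyl hP₁ hP₂
    have hc' : Real.sqrt 2 / 11440 * Real.sqrt (1 - ⟪L e₃, e₃⟫_ℝ ^ 2) ≤ Real.sqrt 6 / 17160 := by
      obtain ⟨h0, h1⟩ := hsin L
      have h26 : Real.sqrt 2 * 17160 ≤ Real.sqrt 6 * 11440 := by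
        rw [show (6 : ℝ) = 3 * 2 by norm_num, Real.sqrt_mul (by norm_num) 2]
        have h3 : (3 / 2 : ℝ) ≤ Real.sqrt 3 := by
          rw [show (3 / 2 : ℝ) = Real.sqrt ((3 / 2) ^ 2) by rw [Real.sqrt_sq (by norm_num)]]
          exact Real.sqrt_le_sqrt (by norm_num)
        nlinarith [Real.sqrt_nonneg 2, h3]
      nlinarith [Real.sqrt_nonneg 2, h0, h1, h26]
    have := mul_le_mul_of_nonneg_right hc' (hπρ ρ)
    linarith only [key, this]
  · -- (B) a doubly skew axis: a skew root of rise `≥ ½`, frame `L`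
    obtain ⟨w, hw, s, hs, hws, hskew, hrise⟩ := exists_skewRoot_of_axis τ k hk A₁
    obtain ⟨C, R₀, hR₀, hmain⟩ := translate_twoSlabAdhesion_general_net hg hc A₁ t₁ A₂ t₂ htrans hw
      (by linarith) hs hws hskew
    refine ⟨L, s₁, s₂, σ, σ', hσ, hσ', hsub₁, hsub₂, C, R₀, hR₀, ?_⟩
    intro h hh ρ hρ X P₁ P₂ hX hP₁X hP₂X₁ hcyl hP₁ hP₂
    have key := hmain h hh ρ hρ X P₁ P₂ hX hP₁X hP₂X₁ hcyl hP₁ hP₂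
    have hc' : Real.sqrt 2 / 11440 * Real.sqrt (1 - ⟪L e₃, e₃⟫_ℝ ^ 2) ≤ Real.sqrt 2 * (A₁ w) 2 / 5720 := by
      obtain ⟨h0, h1⟩ := hsin L
      nlinarith [Real.sqrt_nonneg 2, h0, h1, hrise]
    have := mul_le_mul_of_nonneg_right hc' (hπρ ρ)
    linarith only [key, this]
  · -- (C) a skew `{111}` plane: the defender's frame `L' = A₁ ∘ G`
    obtain ⟨L', hL', hskew⟩ := exists_skewFrame_of_cube A₁ τ c hcube
    have hΛ₂ : A₂ '' fccStacking 1 (Real.sqrt (2 / 3)) = L' '' fccStacking 1 (Real.sqrt (2 / 3)) := by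
      rw [← htrans, hL']
    have hsub₁' : (fun p => A₁ p + t₁) '' fccStacking 1 (Real.sqrt (2 / 3)) ⊆
        (fun p => L' p + t₁) '' barlowStacking 1 (Real.sqrt (2 / 3)) constHagg := by
      rintro _ ⟨q, hq, rfl⟩
      obtain ⟨q', hq', e⟩ : A₁ q ∈ L' '' fccStacking 1 (Real.sqrt (2 / 3)) := by rw [hL']; exact ⟨q, hq, rfl⟩
      exact ⟨q', hq', by simp only [e]⟩
    have hsub₂' : (fun p => A₂ p + t₂) '' fccStacking 1 (Real.sqrt (2 / 3)) ⊆
        (fun p => L' p + t₂) '' barlowStacking 1 (Real.sqrt (2 / 3)) constHagg := by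
      rintro _ ⟨q, hq, rfl⟩
      obtain ⟨q', hq', e⟩ : A₂ q ∈ L' '' fccStacking 1 (Real.sqrt (2 / 3)) := by rw [← hΛ₂]; exact ⟨q, hq, rfl⟩
      exact ⟨q', hq', by simp only [e]⟩
    obtain ⟨C, R₀, hR₀, hmain⟩ := coaxialTwoSlabAdhesion_general_trans_net hg hc A₁ t₁ A₂ t₂ L' t₁ constHagg
      isHaggSeq_const hsub₁' htrans hskew
    refine ⟨L', t₁, t₂, constHagg, constHagg, isHaggSeq_const, isHaggSeq_const, hsub₁', hsub₂', C, R₀, hR₀, ?_⟩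
    intro h hh ρ hρ X P₁ P₂ hX hP₁X hP₂X₁ hcyl hP₁ hP₂
    have key := hmain h hh ρ hρ X P₁ P₂ hX hP₁X hP₂X₁ hcyl hP₁ hP₂
    have hc' : Real.sqrt 2 / 11440 * Real.sqrt (1 - ⟪L' e₃, e₃⟫_ℝ ^ 2) ≤
        Real.sqrt 6 / 11440 * Real.sqrt (1 - ⟪L' e₃, e₃⟫_ℝ ^ 2) := by
      obtain ⟨h0, -⟩ := hsin L'
      have h26 : Real.sqrt 2 ≤ Real.sqrt 6 := Real.sqrt_le_sqrt (by norm_num)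
      nlinarith [h0, h26]
    have := mul_le_mul_of_nonneg_right hc' (hπρ ρ)
    linarith only [key, this]

open scoped Classical in
/-- **THE UNION THEOREM OF BRANCH F (stub form): `CoaxialTwoSlabAdhesion` verbatim with `½ ↦ √2/11440`**, for
EVERY co-axial pair of distinct moved fcc lattices, arbitrary fillings, no residual, h-uniform; kissing facts by
name.  See the module docstring. -/
theorem coaxialTwoSlabAdhesion_smallCharge {δ : ℝ} (hg : KissingGap δ) (hc : KissingClassification δ) :
    ∀ (A₁ : EuclideanSpace ℝ (Fin 3) ≃ₗᵢ[ℝ] EuclideanSpace ℝ (Fin 3)) (t₁ : EuclideanSpace ℝ (Fin 3))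
      (A₂ : EuclideanSpace ℝ (Fin 3) ≃ₗᵢ[ℝ] EuclideanSpace ℝ (Fin 3)) (t₂ : EuclideanSpace ℝ (Fin 3)),
    (∃ (L : EuclideanSpace ℝ (Fin 3) ≃ₗᵢ[ℝ] EuclideanSpace ℝ (Fin 3))
        (s₁ s₂ : EuclideanSpace ℝ (Fin 3)) (σ σ' : ℤ → ℤ), IsHaggSeq σ ∧ IsHaggSeq σ' ∧
        (fun p => A₁ p + t₁) '' fccStacking 1 (Real.sqrt (2 / 3)) ⊆
          (fun p => L p + s₁) '' barlowStacking 1 (Real.sqrt (2 / 3)) σ ∧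
        (fun p => A₂ p + t₂) '' fccStacking 1 (Real.sqrt (2 / 3)) ⊆
          (fun p => L p + s₂) '' barlowStacking 1 (Real.sqrt (2 / 3)) σ') →
    (fun p => A₁ p + t₁) '' fccStacking 1 (Real.sqrt (2 / 3)) ≠
      (fun p => A₂ p + t₂) '' fccStacking 1 (Real.sqrt (2 / 3)) →
    ∃ (L : EuclideanSpace ℝ (Fin 3) ≃ₗᵢ[ℝ] EuclideanSpace ℝ (Fin 3))
        (s₁ s₂ : EuclideanSpace ℝ (Fin 3)) (σ σ' : ℤ → ℤ), IsHaggSeq σ ∧ IsHaggSeq σ' ∧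
        (fun p => A₁ p + t₁) '' fccStacking 1 (Real.sqrt (2 / 3)) ⊆
          (fun p => L p + s₁) '' barlowStacking 1 (Real.sqrt (2 / 3)) σ ∧
        (fun p => A₂ p + t₂) '' fccStacking 1 (Real.sqrt (2 / 3)) ⊆
          (fun p => L p + s₂) '' barlowStacking 1 (Real.sqrt (2 / 3)) σ' ∧
    ∃ C R₀ : ℝ, 1 ≤ R₀ ∧ ∀ h : ℝ, 0 ≤ h → ∀ ρ : ℝ, R₀ ≤ ρ →
      ∀ X P₁ P₂ : Finset (EuclideanSpace ℝ (Fin 3)),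
      (∀ p ∈ X, ∀ q ∈ X, p ≠ q → 1 ≤ dist p q) → P₁ ⊆ X → P₂ ⊆ X \ P₁ →
      (∀ p ∈ X, -(2 * R₀) ≤ p 2 ∧ p 2 ≤ h + 2 * R₀ ∧ p 0 ^ 2 + p 1 ^ 2 ≤ ρ ^ 2) →
      (∀ p, p ∈ P₁ ↔ (p ∈ (fun q => A₁ q + t₁) '' fccStacking 1 (Real.sqrt (2 / 3)) ∧
        -(2 * R₀) ≤ p 2 ∧ p 2 ≤ -R₀ ∧ p 0 ^ 2 + p 1 ^ 2 ≤ ρ ^ 2)) →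
      (∀ p, p ∈ P₂ ↔ (p ∈ (fun q => A₂ q + t₂) '' fccStacking 1 (Real.sqrt (2 / 3)) ∧
        h + R₀ ≤ p 2 ∧ p 2 ≤ h + 2 * R₀ ∧ p 0 ^ 2 + p 1 ^ 2 ≤ ρ ^ 2)) →
      ((((P₁ ×ˢ (X \ P₁)).filter fun pq => dist pq.1 pq.2 = 1).card : ℕ) : ℝ) +
        ((((P₂ ×ˢ ((X \ P₁) \ P₂)).filter fun pq => dist pq.1 pq.2 = 1).card : ℕ) : ℝ) ≤
        contactDeficiency ((X \ P₁) \ P₂) +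
          (Real.sqrt 2 / 4 * ∑ᶠ w ∈ {w ∈ fccStacking 1 (Real.sqrt (2 / 3)) | ‖w‖ = 1},
              |⟪w, A₁.symm (EuclideanSpace.single (2 : Fin 3) (1 : ℝ))⟫_ℝ| +
            Real.sqrt 2 / 4 * ∑ᶠ w ∈ {w ∈ fccStacking 1 (Real.sqrt (2 / 3)) | ‖w‖ = 1},
              |⟪w, A₂.symm (EuclideanSpace.single (2 : Fin 3) (1 : ℝ))⟫_ℝ| -
            (Real.sqrt 2 / 11440 : ℝ) * Real.sqrt (1 - ⟪L (EuclideanSpace.single (2 : Fin 3) (1 : ℝ)),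
              (EuclideanSpace.single (2 : Fin 3) (1 : ℝ))⟫_ℝ ^ 2)) * Real.pi * ρ ^ 2 +
          C * (1 + h) * ρ := by
  intro A₁ t₁ A₂ t₂ hcoax hne
  obtain ⟨L, s₁, s₂, σ, σ', hσ, hσ', hsub₁, hsub₂⟩ := hcoax
  by_cases htrans : A₁ '' fccStacking 1 (Real.sqrt (2 / 3)) = A₂ '' fccStacking 1 (Real.sqrt (2 / 3))
  · exact coaxialTwoSlabAdhesion_translate_smallCharge hg hc A₁ t₁ A₂ t₂ L s₁ s₂ σ σ' hσ hσ' hsub₁ hsub₂ htrans hne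
  · -- twin pair: 19481-p1's in-plane net rung, frame `L`
    obtain ⟨C, R₀, hR₀, hmain⟩ := coaxialTwoSlabAdhesion_general_twin_inPlane hg hc A₁ t₁ A₂ t₂ L s₁ s₂ σ σ'
      hσ hσ' hsub₁ hsub₂ htrans
    refine ⟨L, s₁, s₂, σ, σ', hσ, hσ', hsub₁, hsub₂, C, R₀, hR₀, ?_⟩
    intro h hh ρ hρ X P₁ P₂ hX hP₁X hP₂X₁ hcyl hP₁ hP₂
    have key := hmain h hh ρ hρ X P₁ P₂ hX hP₁X hP₂X₁ hcyl hP₁ hP₂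
    set e₃ : EuclideanSpace ℝ (Fin 3) := EuclideanSpace.single (2 : Fin 3) (1 : ℝ) with he₃
    have hc' : Real.sqrt 2 / 11440 * Real.sqrt (1 - ⟪L e₃, e₃⟫_ℝ ^ 2) ≤
        Real.sqrt 6 / 11440 * Real.sqrt (1 - ⟪L e₃, e₃⟫_ℝ ^ 2) := by
      have h0 : 0 ≤ Real.sqrt (1 - ⟪L e₃, e₃⟫_ℝ ^ 2) := Real.sqrt_nonneg _
      have h26 : Real.sqrt 2 ≤ Real.sqrt 6 := Real.sqrt_le_sqrt (by norm_num)
      nlinarith [h0, h26]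
    have hπρ : 0 ≤ Real.pi * ρ ^ 2 := by positivity
    have := mul_le_mul_of_nonneg_right hc' hπρ
    linarith only [key, this]

end Summit.Ventures.Crystal3D.Theorems

end
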